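import Literature.NumberTheory.ConnesConsani2021.QuasiInnerLocalFactors
import Literature.Analysis.Complex.RectangleResidueSimplePoles
import Mathlib.MeasureTheory.Integral.IntegralEqImproper
import Mathlib.Analysis.Analytic.IsolatedZeros
import Mathlib.Analysis.SpecialFunctions.ImproperIntegrals
import HarnessLib

/-!
# Connes–Consani 2021 (JNT) §3 — the residue computation behind display «offdiag2» — PROOFS

LINE 1 — LABEL: RH-FREE corpus literature (function theory of the ratio `ρ_p` of non-archimedean local
factors; a contour integral of a periodic meromorphic function); bears_on: W-C/W-P (P5 sequel
vocabulary, no leaf role); WHAT THIS IS NOT: any claim about RH — nothing in this file bears on the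
truth of RH.

Source: A. Connes, C. Consani, *Quasi-inner functions and local factors*, J. Number Theory **226**
(2021) 139–167 = arXiv:2008.10974 [bib: `ConnesConsani2021QuasiInner`], §3, the computation of the
negative Fourier coefficients `a^{(p)}_{−k}` of `κ_p = ρ_p ∘ ψ` (arXiv chunk p0008:L24–L69):
«We express these integrals as the sum of residues at the poles `2πin/log p` … To justify this step we
use the same contour as in Section 2 but we choose `R = (2m+1)π/log p` which ensures that the
restriction of `ρ_p` to the segment `(½ + iR, ½ − 2m + iR)` and its complex conjugate fulfills
`|ρ_p(z)| ≤ 1` … To control the integral on the segment `V = (½ − 2m + iR, ½ − 2m − iR)` one simply uses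
the bound `|ρ_p(½ − 2m + is)| ≤ 2(p^{2m−½} − 1)^{−1}` … We can thus apply the residue formula.»

## What is proved (theorems only; vocabulary = seat t17's `QuasiInnerLocalFactors.lean`)

For a prime `p`, `L = log p`, `j ≥ 0`, with the kernel `R_j(z) = ψ⁻¹(z)^j (ψ⁻¹)′(z)`,
`ψ⁻¹(z) = (2z+1)/(2z−3)` (`QuasiInner.cayleyInv`), `(ψ⁻¹)′(z) = −8/(2z−3)²`:

* `rhoPrime_re_add_oddMultiple` — the printed identity on the special horizontal lines
  `Im z = (2m+1)π/log p`: `ρ_p(x + iR) = (1 + p^{x−1})/(1 + p^{−x})` (`= (pˣ + p)/(p^{1−x} + p)`), and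
  `norm_rhoPrime_le_one_of_re_le_half` — `|ρ_p| ≤ 1` there for `x ≤ ½` (p0008:L35–L41).
* `norm_cayleyInv_le_one` — `|ψ⁻¹(z)| ≤ 1` on `ℂ₋ = {Re z ≤ ½}` (ψ⁻¹ maps `ℂ₋` into the closed disk).
* `rectBoundaryIntegral_rhoPrime_kernel` — the residue formula on the printed rectangle
  `[½ − 2m, ½] × [−(2m+1)π/L, (2m+1)π/L]`: the boundary integral of `ρ_p R_j` equals
  `2πi Σ_{|n| ≤ m} 8(1 − p⁻¹)L (4πn + 3iL)⁻² x_p(n)^j` (the printed residues, p0008:L55–L57; the tree's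
  `Literature.Analysis.Complex.rectBoundaryIntegral_eq_sum_of_simplePoles` is the residue theorem).
* **`hasSum_residues_rhoPrime_kernel`** — letting `m → ∞` (three sides → 0 by the bounds above):
  `Σ_{n ∈ ℤ} 8(1 − p⁻¹)L (4πn + 3iL)⁻² x_p(n)^j = (1/2π) ∫_ℝ ρ_p(½ + iy) R_j(½ + iy) dy`
  (absolutely convergent on both sides) — i.e. the printed
  `a^{(p)}_{−k} = 8(1 − 1/p) log p Σ_ℤ (4πn + 3i log p)^{−2} x_p(n)^{k−1}` once the left side is read as
  `(1/2πi)∫_{S¹} κ_p(v) v^{k−1} dv` transported to the critical line (that change of variables is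
  seat t17's lemma and is NOT restated here).

No definitions, no named facts; nothing here bears on the truth of RH.
-/

noncomputable section

open _root_.Complex Set MeasureTheory Filter intervalIntegral
open scoped Real Topology

namespace Literature.NumberTheory.ConnesConsani2021

namespace QuasiInner

/-! ### The special horizontal lines `Im z = (2m+1)π/log p` -/

/-- `p^{iR} = −1` for `R = (2m+1)π/log p`. [cite: ConnesConsani2021QuasiInner, §3 (arXiv chunk p0008:L35–L39)] -/
private theorem natCast_cpow_oddMultiple_mul_I {p : ℕ} (hp : 1 < p) (m : ℤ) :
    (p : ℂ) ^ ((((2 * m + 1) * π / Real.log p : ℝ) : ℂ) * I) = -1 := by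
  have hp0 : (p : ℂ) ≠ 0 := Nat.cast_ne_zero.2 (by omega)
  have hlogR : 0 < Real.log p := Real.log_pos (by exact_mod_cast hp)
  rw [cpow_def_of_ne_zero hp0, ← Complex.natCast_log]
  have hreal : Real.log p * ((2 * m + 1) * π / Real.log p) = (2 * m + 1) * π := by
    field_simp
  have : ((Real.log (p : ℝ) : ℝ) : ℂ) * ((((2 * m + 1) * π / Real.log p : ℝ) : ℂ) * I) =
      (m : ℂ) * (2 * π * I) + π * I := by
    rw [← mul_assoc, ← ofReal_mul, hreal]
    push_cast
    ring
  rw [this, Complex.exp_add, Complex.exp_int_mul_two_pi_mul_I, Complex.exp_pi_mul_I, one_mul]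

/-- **`ρ_p` on the horizontal lines `Im z = (2m+1)π/log p`** (printed: «`ρ_p(x + i(2m+1)π/log p) =
(pˣ + p)/(p^{1−x} + p)`, a real, positive increasing function of `x` equal to `1` for `x = ½`»), in the
form `ρ_p(x + iR) = (1 + p^{x−1})/(1 + p^{−x})` (multiply by `p` to get the printed quotient); `m ∈ ℤ`
covers the complex-conjugate line `−R` as well. [cite: ConnesConsani2021QuasiInner, §3 (arXiv chunk p0008:L35–L39)] -/
theorem rhoPrime_re_add_oddMultiple {p : ℕ} (hp : 1 < p) (m : ℤ) (x : ℝ) :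
    rhoPrime p (x + (((2 * m + 1) * π / Real.log p : ℝ) : ℂ) * I) =
      (((1 + (p : ℝ) ^ (x - 1)) / (1 + (p : ℝ) ^ (-x)) : ℝ) : ℂ) := by
  have hp0 : (p : ℂ) ≠ 0 := Nat.cast_ne_zero.2 (by omega)
  have hpR : (0 : ℝ) ≤ p := by positivity
  set R : ℝ := (2 * m + 1) * π / Real.log p with hR
  have hI : (p : ℂ) ^ ((R : ℂ) * I) = -1 := by rw [hR]; exact natCast_cpow_oddMultiple_mul_I hp m
  have h1 : (p : ℂ) ^ ((x : ℂ) + (R : ℂ) * I - 1) = -(((p : ℝ) ^ (x - 1) : ℝ) : ℂ) := by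
    rw [show (x : ℂ) + (R : ℂ) * I - 1 = ((x - 1 : ℝ) : ℂ) + (R : ℂ) * I by push_cast; ring,
      cpow_add _ _ hp0, hI, ← ofReal_natCast, ← ofReal_cpow hpR]
    ring
  have h2 : (p : ℂ) ^ (-((x : ℂ) + (R : ℂ) * I)) = -(((p : ℝ) ^ (-x) : ℝ) : ℂ) := by
    rw [show -((x : ℂ) + (R : ℂ) * I) = ((-x : ℝ) : ℂ) + (-((R : ℂ) * I)) by push_cast; ring,
      cpow_add _ _ hp0, cpow_neg, hI, ← ofReal_natCast, ← ofReal_cpow hpR]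
    ring
  rw [rhoPrime, h1, h2]
  push_cast
  ring

/-- **`|ρ_p(z)| ≤ 1` on the lines `Im z = (2m+1)π/log p` for `Re z ≤ ½`** («which ensures that the
restriction of `ρ_p` to the segment `(½ + iR, ½ − 2m + iR)` and its complex conjugate fulfills
`|ρ_p(z)| ≤ 1`»: `p^{x−1} ≤ p^{−x}` iff `x ≤ ½`).
[cite: ConnesConsani2021QuasiInner, §3 (arXiv chunk p0008:L35–L41)] -/
theorem norm_rhoPrime_le_one_of_re_le_half {p : ℕ} (hp : 1 < p) (m : ℤ) {x : ℝ} (hx : x ≤ 1 / 2) :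
    ‖rhoPrime p (x + (((2 * m + 1) * π / Real.log p : ℝ) : ℂ) * I)‖ ≤ 1 := by
  have hp1 : (1 : ℝ) < p := by exact_mod_cast hp
  rw [rhoPrime_re_add_oddMultiple hp m x, Complex.norm_real, Real.norm_eq_abs,
    abs_of_pos (by positivity)]
  rw [div_le_one (by positivity)]
  have : (p : ℝ) ^ (x - 1) ≤ (p : ℝ) ^ (-x) := Real.rpow_le_rpow_of_exponent_le hp1.le (by linarith)
  linarith

/-! ### The kernel `R_j = (ψ⁻¹)^j (ψ⁻¹)′` -/

/-- **`|ψ⁻¹(z)| ≤ 1` for `Re z ≤ ½`**: `ψ⁻¹(z) = (2z+1)/(2z−3)` maps `ℂ₋` into the closed unit disk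
(`|2z + 1| ≤ |2z − 3|` iff `Re z ≤ ½`). [cite: ConnesConsani2021QuasiInner, Introduction (arXiv chunk p0003:L26)] -/
theorem norm_cayleyInv_le_one {z : ℂ} (hz : z.re ≤ 1 / 2) : ‖cayleyInv z‖ ≤ 1 := by
  rw [cayleyInv]
  have hden : (2 * z - 3 : ℂ) ≠ 0 := by
    intro h
    have := congrArg Complex.re h
    simp at this
    linarith
  rw [norm_div, div_le_one (norm_pos_iff.2 hden)]
  rw [← sq_le_sq₀ (norm_nonneg _) (norm_nonneg _), Complex.sq_norm, Complex.sq_norm]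
  simp only [normSq_apply, sub_re, mul_re, add_re, sub_im, mul_im, add_im]
  norm_num
  nlinarith

/-- `2z − 3 ≠ 0` for `Re z < 3/2`. [folklore] -/
private theorem two_mul_sub_three_ne_zero {z : ℂ} (hz : z.re < 3 / 2) : (2 * z - 3 : ℂ) ≠ 0 := by
  intro h
  have := congrArg Complex.re h
  simp at this
  linarith

/-- `|2z − 3| ≥ 2|Im z|`. [folklore] -/
private theorem two_mul_abs_im_le_norm (z : ℂ) : 2 * |z.im| ≤ ‖2 * z - 3‖ := by
  have h := Complex.abs_im_le_norm (2 * z - 3)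
  have : (2 * z - 3 : ℂ).im = 2 * z.im := by simp
  rw [this, abs_mul, abs_two] at h
  exact h

/-- `|2z − 3| ≥ |2 Re z − 3|`. [folklore] -/
private theorem abs_re_le_norm' (z : ℂ) : |2 * z.re - 3| ≤ ‖2 * z - 3‖ := by
  have h := Complex.abs_re_le_norm (2 * z - 3)
  have : (2 * z - 3 : ℂ).re = 2 * z.re - 3 := by simp
  rwa [this] at h

/-- The norm of `(ψ⁻¹)′(z) = −8/(2z−3)²`. [folklore] -/
private theorem norm_neg_eight_div (z : ℂ) : ‖(-8 : ℂ) / (2 * z - 3) ^ 2‖ = 8 / ‖2 * z - 3‖ ^ 2 := by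
  rw [norm_div, norm_neg, norm_pow]
  norm_num

/-- **Bound of the kernel on `ℂ₋`**: `|R_j(z)| ≤ 8/|2z − 3|²` for `Re z ≤ ½`.
[cite: ConnesConsani2021QuasiInner, §3 (arXiv chunk p0008:L41–L47)] -/
theorem norm_kernel_le {z : ℂ} (hz : z.re ≤ 1 / 2) (j : ℕ) :
    ‖cayleyInv z ^ j * ((-8 : ℂ) / (2 * z - 3) ^ 2)‖ ≤ 8 / ‖2 * z - 3‖ ^ 2 := by
  rw [norm_mul, norm_pow, norm_neg_eight_div]
  have h1 : ‖cayleyInv z‖ ^ j ≤ 1 := pow_le_one₀ (norm_nonneg _) (norm_cayleyInv_le_one hz)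
  have h2 : 0 ≤ 8 / ‖2 * z - 3‖ ^ 2 := by positivity
  calc ‖cayleyInv z‖ ^ j * (8 / ‖2 * z - 3‖ ^ 2) ≤ 1 * (8 / ‖2 * z - 3‖ ^ 2) := by gcongr
    _ = _ := one_mul _

/-! ### The poles `2πin/log p` of `ρ_p`: local structure `F = φ/(z − z_n)` -/

/-- `p^{−z} = 1` exactly on `(2πi/log p)ℤ` (the zeros of the denominator `1 − p^{−z}` of `ρ_p`; Lemma 3.1
(ii)). [cite: ConnesConsani2021QuasiInner, Lemma 3.1 (ii) (arXiv chunk p0008:L11–L17)] -/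
theorem natCast_cpow_neg_eq_one_iff {p : ℕ} (hp : 1 < p) (z : ℂ) :
    (p : ℂ) ^ (-z) = 1 ↔ ∃ k : ℤ, z = 2 * π * I * k / Real.log p := by
  have hp0 : (p : ℂ) ≠ 0 := Nat.cast_ne_zero.2 (by omega)
  have hlogR : 0 < Real.log p := Real.log_pos (by exact_mod_cast hp)
  have hlog : (Real.log p : ℂ) ≠ 0 := ofReal_ne_zero.2 hlogR.ne'
  rw [cpow_def_of_ne_zero hp0, ← Complex.natCast_log, Complex.exp_eq_one_iff]
  constructor
  · rintro ⟨k, hk⟩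
    refine ⟨-k, ?_⟩
    rw [eq_div_iff hlog, Int.cast_neg]
    linear_combination -hk
  · rintro ⟨k, hk⟩
    refine ⟨-k, ?_⟩
    rw [hk, Int.cast_neg]
    field_simp

/-- `p^{−z_n} = 1` at the pole `z_n = 2πin/log p`. [cite: ConnesConsani2021QuasiInner, Lemma 3.1 (ii) (arXiv chunk p0008:L13)] -/
theorem natCast_cpow_neg_pole {p : ℕ} (hp : 1 < p) (n : ℤ) :
    (p : ℂ) ^ (-(2 * π * I * n / Real.log p : ℂ)) = 1 :=
  (natCast_cpow_neg_eq_one_iff hp _).2 ⟨n, rfl⟩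

/-- `p^{z_n − 1} = p⁻¹` at the pole `z_n = 2πin/log p` (so the numerator of `ρ_p` is `1 − 1/p` there).
[cite: ConnesConsani2021QuasiInner, Lemma 3.1 (ii), proof (arXiv chunk p0008:L13–L17)] -/
theorem natCast_cpow_pole_sub_one {p : ℕ} (hp : 1 < p) (n : ℤ) :
    (p : ℂ) ^ ((2 * π * I * n / Real.log p : ℂ) - 1) = (p : ℂ)⁻¹ := by
  have hp0 : (p : ℂ) ≠ 0 := Nat.cast_ne_zero.2 (by omega)
  have h1 := natCast_cpow_neg_pole hp n
  rw [cpow_neg, inv_eq_one] at h1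
  rw [cpow_sub _ _ hp0, h1, cpow_one, one_div]

/-- The derivative of the denominator: `d/dz (1 − p^{−z}) = p^{−z} log p`. [folklore] -/
private theorem hasDerivAt_den {p : ℕ} (hp : 1 < p) (z : ℂ) :
    HasDerivAt (fun w : ℂ => 1 - (p : ℂ) ^ (-w)) ((p : ℂ) ^ (-z) * Real.log p) z := by
  have hp0 : (p : ℂ) ≠ 0 := Nat.cast_ne_zero.2 (by omega)
  have h : HasDerivAt (fun w : ℂ => (p : ℂ) ^ (-w)) ((p : ℂ) ^ (-z) * Complex.log p * (-1)) z :=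
    (hasDerivAt_neg z).const_cpow (Or.inl hp0)
  have h2 := (hasDerivAt_const z (1 : ℂ)).sub h
  rw [← Complex.natCast_log] at h2
  have e : (0 : ℂ) - (p : ℂ) ^ (-z) * (Real.log p : ℂ) * (-1) = (p : ℂ) ^ (-z) * Real.log p := by ring
  rw [e] at h2
  exact h2

/-- The denominator `1 − p^{−z}` is entire. [folklore] -/
private theorem differentiable_den {p : ℕ} (hp : 1 < p) :
    Differentiable ℂ (fun w : ℂ => 1 - (p : ℂ) ^ (-w)) := fun z =>
  (hasDerivAt_den hp z).differentiableAt

/-- The numerator `1 − p^{z−1}` is entire. [folklore] -/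
private theorem differentiable_num {p : ℕ} (hp : 1 < p) :
    Differentiable ℂ (fun w : ℂ => 1 - (p : ℂ) ^ (w - 1)) := by
  have hp0 : (p : ℂ) ≠ 0 := Nat.cast_ne_zero.2 (by omega)
  exact (differentiable_const _).sub ((differentiable_id.sub_const (1 : ℂ)).const_cpow (Or.inl hp0))

/-- The kernel `ψ⁻¹(z)^j · (−8)/(2z−3)²` is complex differentiable off `z = 3/2`. [folklore] -/
private theorem differentiableAt_kernel {z : ℂ} (hz : (2 * z - 3 : ℂ) ≠ 0) (j : ℕ) :
    DifferentiableAt ℂ (fun w : ℂ => cayleyInv w ^ j * ((-8 : ℂ) / (2 * w - 3) ^ 2)) z := by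
  have h1 : DifferentiableAt ℂ (fun w : ℂ => 2 * w - 3) z := by fun_prop
  have h2 : DifferentiableAt ℂ (fun w : ℂ => 2 * w + 1) z := by fun_prop
  have hc : DifferentiableAt ℂ cayleyInv z := by
    have : cayleyInv = fun w : ℂ => (2 * w + 1) / (2 * w - 3) := rfl
    rw [this]
    exact h2.div h1 hz
  exact (hc.pow j).mul ((differentiableAt_const _).div (h1.pow 2) (pow_ne_zero 2 hz))

/-- The printed identities at the pole `z_n = 2πin/log p`: `(2z_n+1)/(2z_n−3) = x_p(n)` and
`−8/(2z_n−3)² = 8log²p/(4πn + 3i log p)²`, giving the residue coefficient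
`((1 − 1/p)/log p) · ψ⁻¹(z_n)^j · (−8)/(2z_n−3)² = 8(1 − 1/p) log p (4πn + 3i log p)^{−2} x_p(n)^j`.
[cite: ConnesConsani2021QuasiInner, §3 (arXiv chunk p0008:L49–L57)] -/
theorem residueCoeff_eq {p : ℕ} (hp : 1 < p) (n : ℤ) (j : ℕ) :
    (1 - (p : ℂ)⁻¹) / Real.log p *
        (cayleyInv (2 * π * I * n / Real.log p) ^ j *
          ((-8 : ℂ) / (2 * (2 * π * I * n / Real.log p) - 3) ^ 2)) =
      8 * (1 - (p : ℂ)⁻¹) * Real.log p / (4 * π * n + 3 * I * Real.log p) ^ 2 * xPrime p n ^ j := by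
  have hlogR : 0 < Real.log p := Real.log_pos (by exact_mod_cast hp)
  set L : ℝ := Real.log p with hL
  have hL0 : (L : ℂ) ≠ 0 := ofReal_ne_zero.2 hlogR.ne'
  set zn : ℂ := 2 * π * I * n / L with hzn
  have h23 : 2 * zn - 3 = I * (4 * π * n + 3 * I * L) / L := by
    rw [hzn]; field_simp; ring_nf; rw [I_sq]; ring
  have hD : (4 * π * n + 3 * I * L : ℂ) ≠ 0 := by
    intro h
    have := congrArg Complex.im h
    simp at this
    exact hlogR.ne' this
  rw [← xPrime_eq_cayleyInv hp n, h23]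
  field_simp
  ring_nf
  rw [I_sq]
  ring

/-- **Local structure at the simple poles** (Lemma 3.1 (ii) in the concrete form used by the residue
theorem): near `z_n = 2πin/log p` one has `ρ_p(z)R_j(z) = φ(z)/(z − z_n)` with `φ` complex differentiable
near `z_n` and `φ(z_n) = ((1 − 1/p)/log p)·R_j(z_n)` («To obtain the residue one multiplies by
`(1 − 1/p)/log p` as shown from periodicity and the expansion at `z = 0`»); `φ = (1 − p^{z−1})R_j / dslope(1 − p^{−z})`.
[cite: ConnesConsani2021QuasiInner, §3 (arXiv chunk p0008:L49–L57) with Lemma 3.1 (ii) (p0008:L11–L17)] -/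
theorem exists_pole_structure_rhoPrime_kernel {p : ℕ} (hp : 1 < p) (j : ℕ) (n : ℤ) :
    ∃ φ : ℂ → ℂ, ∃ V ∈ 𝓝 (2 * π * I * n / Real.log p : ℂ), DifferentiableOn ℂ φ V ∧
      φ (2 * π * I * n / Real.log p) =
        (1 - (p : ℂ)⁻¹) / Real.log p *
          (cayleyInv (2 * π * I * n / Real.log p) ^ j *
            ((-8 : ℂ) / (2 * (2 * π * I * n / Real.log p) - 3) ^ 2)) ∧
      ∀ z ∈ V, z ≠ 2 * π * I * n / Real.log p →
        rhoPrime p z * (cayleyInv z ^ j * ((-8 : ℂ) / (2 * z - 3) ^ 2)) =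
          φ z / (z - 2 * π * I * n / Real.log p) := by
  have hp0 : (p : ℂ) ≠ 0 := Nat.cast_ne_zero.2 (by omega)
  have hlogR : 0 < Real.log p := Real.log_pos (by exact_mod_cast hp)
  set L : ℝ := Real.log p with hL
  have hL0 : (L : ℂ) ≠ 0 := ofReal_ne_zero.2 hlogR.ne'
  set c : ℂ := 2 * π * I * n / L with hc
  set D : ℂ → ℂ := fun w => 1 - (p : ℂ) ^ (-w) with hDdef
  set N : ℂ → ℂ := fun w => 1 - (p : ℂ) ^ (w - 1) with hNdef
  set K : ℂ → ℂ := fun w => cayleyInv w ^ j * ((-8 : ℂ) / (2 * w - 3) ^ 2) with hKdef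
  have hDc : D c = 0 := by
    simp only [hDdef, hc]
    rw [natCast_cpow_neg_pole hp n, sub_self]
  have hD' : deriv D c = (p : ℂ) ^ (-c) * L := (hasDerivAt_den hp c).deriv
  have hD'ne : deriv D c ≠ 0 := by
    rw [hD', hc, natCast_cpow_neg_pole hp n, one_mul]
    exact hL0
  -- analyticity of `dslope D c` at `c`
  have hDan : AnalyticAt ℂ D c := (differentiable_den hp).analyticAt c
  obtain ⟨q, hq⟩ := hDan
  have hds_an : AnalyticAt ℂ (dslope D c) c := (hq.has_fpower_series_dslope_fslope).analyticAt
  have hds_c : dslope D c c ≠ 0 := by rwa [dslope_same]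
  have hre : c.re < 1 := by
    rw [hc, Complex.div_ofReal_re]
    simp
  -- the neighbourhood
  have hev1 : ∀ᶠ z in 𝓝 c, dslope D c z ≠ 0 := hds_an.continuousAt.eventually_ne hds_c
  have hev2 : ∀ᶠ z in 𝓝 c, AnalyticAt ℂ (dslope D c) z := hds_an.eventually_analyticAt
  have hev3 : ∀ᶠ z in 𝓝 c, z.re < 1 := Complex.continuous_re.continuousAt.eventually_lt continuousAt_const hre
  refine ⟨fun z => N z * K z / dslope D c z, {z | dslope D c z ≠ 0 ∧ AnalyticAt ℂ (dslope D c) z ∧ z.re < 1},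
    (hev1.and (hev2.and hev3)), ?_, ?_, ?_⟩
  · -- differentiable on V
    intro z hz
    obtain ⟨hz1, hz2, hz3⟩ := hz
    have h23 : (2 * z - 3 : ℂ) ≠ 0 := two_mul_sub_three_ne_zero (by linarith)
    exact (((differentiable_num hp z).mul (differentiableAt_kernel h23 j)).div
      hz2.differentiableAt hz1).differentiableWithinAt
  · -- value at the pole
    simp only
    rw [dslope_same, hD', hc, natCast_cpow_neg_pole hp n, one_mul]
    simp only [hNdef]
    rw [natCast_cpow_pole_sub_one hp n]
    ring
  · -- the factorisation off the pole
    intro z hz hzc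
    obtain ⟨hz1, -, -⟩ := hz
    have hfac : D z = (z - c) * dslope D c z := by
      have := sub_smul_dslope D c z
      rw [smul_eq_mul, hDc, sub_zero] at this
      exact this.symm
    have hzc' : (z - c : ℂ) ≠ 0 := sub_ne_zero.2 hzc
    have hrho : rhoPrime p z = N z / D z := rfl
    simp only [hKdef]
    rw [hrho, hfac]
    field_simp

/-! ### The residue formula on the printed rectangles -/

/-- `ρ_p = (1 − p^{z−1})/(1 − p^{−z})` as functions (unfolding). [cite: ConnesConsani2021QuasiInner, §3 first display (arXiv chunk p0008:L6)] -/
private theorem rhoPrime_eq_fun (p : ℕ) :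
    rhoPrime p = fun z : ℂ => (1 - (p : ℂ) ^ (z - 1)) / (1 - (p : ℂ) ^ (-z)) := rfl

/-- Real and imaginary part of the pole `z_n = 2πin/log p`. [cite: ConnesConsani2021QuasiInner, Lemma 3.1 (ii) (arXiv chunk p0008:L11)] -/
private theorem pole_re_im (p : ℕ) (n : ℤ) :
    (2 * π * I * n / Real.log p : ℂ).re = 0 ∧
      (2 * π * I * n / Real.log p : ℂ).im = 2 * π * n / Real.log p := by
  constructor
  · rw [Complex.div_ofReal_re]; simp
  · rw [Complex.div_ofReal_im]; simp

/-- **The residue formula on the rectangle `[½ − 2m, ½] × [−(2m+1)π/log p, (2m+1)π/log p]`**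
(`m ≥ 1`): the boundary integral of `ρ_p(z)·ψ⁻¹(z)^j·(ψ⁻¹)′(z)` equals `2πi` times the sum of the
printed residues `8(1 − 1/p) log p (4πn + 3i log p)^{−2} x_p(n)^j` over the enclosed poles `|n| ≤ m`
(«We can thus apply the residue formula»; residue theorem = the tree's
`Literature.Analysis.Complex.rectBoundaryIntegral_eq_sum_of_simplePoles`).
[cite: ConnesConsani2021QuasiInner, §3 (arXiv chunk p0008:L30–L57)] -/
theorem rectBoundaryIntegral_rhoPrime_kernel {p : ℕ} (hp : p.Prime) (j : ℕ) {m : ℕ} (hm : 1 ≤ m) :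
    Literature.Analysis.Complex.rectBoundaryIntegral
        (fun z : ℂ => rhoPrime p z * (cayleyInv z ^ j * ((-8 : ℂ) / (2 * z - 3) ^ 2)))
        (1 / 2 - 2 * m) (1 / 2) (-((2 * m + 1) * π / Real.log p)) ((2 * m + 1) * π / Real.log p) =
      2 * π * I * ∑ n ∈ Finset.Icc (-(m : ℤ)) m,
        8 * (1 - (p : ℂ)⁻¹) * Real.log p / (4 * π * n + 3 * I * Real.log p) ^ 2 * xPrime p n ^ j := by
  have hp1 : 1 < p := hp.one_lt
  have hp0 : (p : ℂ) ≠ 0 := Nat.cast_ne_zero.2 (by omega)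
  have hlogR : 0 < Real.log p := Real.log_pos (by exact_mod_cast hp1)
  have hm1 : (1 : ℝ) ≤ m := by exact_mod_cast hm
  set L : ℝ := Real.log p with hL
  set R : ℝ := (2 * m + 1) * π / L with hR
  set R' : ℝ := 2 * π * (m + 1) / L with hR'
  have hR0 : 0 < R := by positivity
  have hRR' : R < R' := by
    rw [hR, hR', div_lt_div_iff_of_pos_right hlogR]; nlinarith [Real.pi_pos]
  set zP : ℤ → ℂ := fun n => 2 * π * I * n / L with hzP
  have hzP_im : ∀ n : ℤ, (zP n).im = 2 * π * n / L := fun n => (pole_re_im p n).2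
  have hzP_re : ∀ n : ℤ, (zP n).re = 0 := fun n => (pole_re_im p n).1
  have hzP_inj : Function.Injective zP := by
    intro a b h
    have := congrArg Complex.im h
    rw [hzP_im, hzP_im, div_left_inj' hlogR.ne'] at this
    have h2 : (a : ℝ) = b := by nlinarith [Real.pi_pos]
    exact_mod_cast h2
  set S : Finset ℂ := (Finset.Icc (-(m : ℤ)) m).image zP with hS
  set F : ℂ → ℂ := fun z => rhoPrime p z * (cayleyInv z ^ j * ((-8 : ℂ) / (2 * z - 3) ^ 2)) with hF
  set r : ℂ → ℂ := fun z => (1 - (p : ℂ)⁻¹) / L * (cayleyInv z ^ j * ((-8 : ℂ) / (2 * z - 3) ^ 2))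
    with hr
  set U : Set ℂ := Ioo (1 / 2 - 2 * (m : ℝ) - 1) 1 ×ℂ Ioo (-R') R' with hU
  have hUo : IsOpen U := isOpen_Ioo.reProdIm isOpen_Ioo
  have hab : (1 / 2 - 2 * (m : ℝ)) < 1 / 2 := by linarith
  have hcd : -R < R := by linarith
  -- the closed rectangle sits inside `U`
  have hKU : Icc (1 / 2 - 2 * (m : ℝ)) (1 / 2) ×ℂ Icc (-R) R ⊆ U := by
    intro z hz
    rw [mem_reProdIm] at hz ⊢
    exact ⟨⟨by linarith [hz.1.1], by linarith [hz.1.2]⟩, ⟨by linarith [hz.2.1], by linarith [hz.2.2]⟩⟩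
  -- the poles `|n| ≤ m` are inside the open rectangle
  have hSsub : (S : Set ℂ) ⊆ Ioo (1 / 2 - 2 * (m : ℝ)) (1 / 2) ×ℂ Ioo (-R) R := by
    intro z hz
    rw [hS, Finset.coe_image] at hz
    obtain ⟨n, hn, rfl⟩ := hz
    rw [Finset.coe_Icc, mem_Icc] at hn
    have hn' : |(n : ℝ)| ≤ m := by
      rw [← Int.cast_abs]; exact_mod_cast abs_le.2 hn
    rw [mem_reProdIm, hzP_re, hzP_im]
    refine ⟨⟨by linarith, by linarith⟩, ?_⟩
    rw [mem_Ioo, hR, neg_lt, lt_div_iff₀ hlogR, ← neg_div, div_mul_cancel₀ _ hlogR.ne',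
      div_lt_div_iff_of_pos_right hlogR]
    constructor <;> nlinarith [abs_le.1 hn', Real.pi_pos]
  -- off the poles inside `U` the function is holomorphic
  have hF : DifferentiableOn ℂ F (U \ ↑S) := by
    intro z hz
    obtain ⟨hzU, hzS⟩ := hz
    rw [hU, mem_reProdIm] at hzU
    have h23 : (2 * z - 3 : ℂ) ≠ 0 := two_mul_sub_three_ne_zero (by linarith [hzU.1.2])
    have hD : (1 - (p : ℂ) ^ (-z)) ≠ 0 := by
      intro h
      have h1 : (p : ℂ) ^ (-z) = 1 := (sub_eq_zero.1 h).symm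
      obtain ⟨k, hk⟩ := (natCast_cpow_neg_eq_one_iff hp1 z).1 h1
      have him : |2 * π * k / L| < R' := by
        have := hzU.2
        rw [hk] at this
        rw [show (2 * π * I * k / Real.log p : ℂ).im = 2 * π * k / L from (pole_re_im p k).2] at this
        exact abs_lt.2 this
      have hk' : |(k : ℝ)| < m + 1 := by
        rw [abs_div, abs_of_pos hlogR, hR', div_lt_div_iff_of_pos_right hlogR, abs_mul,
          abs_of_pos (by positivity : (0:ℝ) < 2 * π)] at him
        nlinarith [Real.pi_pos, abs_nonneg (k : ℝ)]
      have hkm : |k| ≤ (m : ℤ) := by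
        have : |(k : ℝ)| < (m : ℤ) + 1 := by push_cast; exact hk'
        rw [← Int.cast_abs] at this
        exact Int.lt_add_one_iff.1 (by exact_mod_cast this)
      apply hzS
      rw [hS, Finset.coe_image]
      exact ⟨k, by rw [Finset.coe_Icc, mem_Icc]; exact abs_le.1 hkm, hk.symm⟩
    have hrho : DifferentiableAt ℂ (rhoPrime p) z := by
      rw [rhoPrime_eq_fun]
      exact ((differentiable_num hp1 z).div (differentiable_den hp1 z) hD)
    exact (hrho.mul (differentiableAt_kernel h23 j)).differentiableWithinAt
  -- the local structure at each pole
  have hpole : ∀ q ∈ S, ∃ φ : ℂ → ℂ, ∃ V ∈ 𝓝 q, DifferentiableOn ℂ φ V ∧ φ q = r q ∧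
      ∀ z ∈ V, z ≠ q → F z = φ z / (z - q) := by
    intro q hq
    rw [hS, Finset.mem_image] at hq
    obtain ⟨n, -, rfl⟩ := hq
    exact exists_pole_structure_rhoPrime_kernel hp1 j n
  have key := Literature.Analysis.Complex.rectBoundaryIntegral_eq_sum_of_simplePoles hab hcd S F r U
    hUo hKU hSsub hF hpole
  rw [key, hS, Finset.sum_image fun a _ b _ h => hzP_inj h]
  congr 1
  refine Finset.sum_congr rfl fun n _ => ?_
  exact residueCoeff_eq hp1 n j

/-! ### Letting `m → ∞`: absolute convergence of the residue series -/

/-- **The residues are absolutely summable**: `|8(1 − p⁻¹) log p (4πn + 3i log p)⁻² x_p(n)^j| ≤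
8 log p/(16π²n²)` for `n ≠ 0` (`|x_p(n)| < 1`, `|4πn + 3i log p|² = 16π²n² + 9 log²p`).
[cite: ConnesConsani2021QuasiInner, §3 (arXiv chunk p0008:L60–L64)] -/
theorem summable_residues_rhoPrime_kernel {p : ℕ} (hp : 1 < p) (j : ℕ) :
    Summable fun n : ℤ => 8 * (1 - (p : ℂ)⁻¹) * Real.log p / (4 * π * n + 3 * I * Real.log p) ^ 2 *
      xPrime p n ^ j := by
  have hp1 : (1 : ℝ) < p := by exact_mod_cast hp
  have hlogR : 0 < Real.log p := Real.log_pos hp1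
  refine Summable.of_norm_bounded_eventually
    (((Real.summable_one_div_int_pow (p := 2)).2 one_lt_two).mul_left (8 * Real.log p / (16 * π ^ 2))) ?_
  rw [Filter.eventually_cofinite]
  refine (Set.finite_singleton (0 : ℤ)).subset fun n hn => ?_
  rw [Set.mem_singleton_iff]
  by_contra h0
  apply hn
  have hn0 : (n : ℝ) ≠ 0 := by exact_mod_cast h0
  have hn2 : 0 < (n : ℝ) ^ 2 := by positivity
  have h1 : ‖(1 : ℂ) - (p : ℂ)⁻¹‖ ≤ 1 := by
    have hp0 : (0 : ℝ) ≤ (p : ℝ)⁻¹ := by positivity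
    have hp1' : (p : ℝ)⁻¹ ≤ 1 := inv_le_one_of_one_le₀ hp1.le
    rw [show (1 : ℂ) - (p : ℂ)⁻¹ = ((1 - (p : ℝ)⁻¹ : ℝ) : ℂ) by push_cast; ring, Complex.norm_real,
      Real.norm_eq_abs, abs_of_nonneg (by linarith)]
    linarith
  have h2 : ‖xPrime p n ^ j‖ ≤ 1 := by
    rw [norm_pow]; exact pow_le_one₀ (norm_nonneg _) (norm_xPrime_lt_one hp n).le
  have h3 : 16 * π ^ 2 * (n : ℝ) ^ 2 ≤ ‖(4 * π * n + 3 * I * Real.log p : ℂ)‖ ^ 2 := by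
    rw [show (4 * π * n + 3 * I * Real.log p : ℂ) = ((4 * π * n : ℝ) : ℂ) + ((3 * Real.log p : ℝ) : ℂ) * I
      by push_cast; ring, Complex.sq_norm, Complex.normSq_add_mul_I]
    nlinarith [sq_nonneg (3 * Real.log p)]
  calc ‖8 * (1 - (p : ℂ)⁻¹) * Real.log p / (4 * π * n + 3 * I * Real.log p) ^ 2 * xPrime p n ^ j‖
      = 8 * ‖(1 : ℂ) - (p : ℂ)⁻¹‖ * Real.log p / ‖(4 * π * n + 3 * I * Real.log p : ℂ)‖ ^ 2 *
          ‖xPrime p n ^ j‖ := by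
        rw [norm_mul, norm_div, norm_pow, norm_mul, norm_mul, Complex.norm_real,
          Real.norm_of_nonneg hlogR.le]
        norm_num
    _ ≤ 8 * 1 * Real.log p / (16 * π ^ 2 * (n : ℝ) ^ 2) * 1 := by
        have hA : 0 ≤ 8 * ‖(1 : ℂ) - (p : ℂ)⁻¹‖ * Real.log p := by positivity
        calc _ ≤ 8 * ‖(1 : ℂ) - (p : ℂ)⁻¹‖ * Real.log p / (16 * π ^ 2 * (n : ℝ) ^ 2) * 1 := by
              refine mul_le_mul (div_le_div_of_nonneg_left hA (by positivity) h3) h2 (norm_nonneg _)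
                (div_nonneg hA (by positivity))
          _ ≤ _ := by gcongr
    _ = 8 * Real.log p / (16 * π ^ 2) * (1 / (n : ℝ) ^ 2) := by ring

/-! ### Letting `m → ∞`: the three far sides vanish, the near side converges -/

/-- The denominator `1 − p^{−z}` of `ρ_p` vanishes only on the imaginary axis.
[cite: ConnesConsani2021QuasiInner, Lemma 3.1 (ii) (arXiv chunk p0008:L11)] -/
private theorem one_sub_cpow_neg_ne_zero {p : ℕ} (hp : 1 < p) {z : ℂ} (hz : z.re ≠ 0) :
    (1 : ℂ) - (p : ℂ) ^ (-z) ≠ 0 := by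
  intro h
  obtain ⟨k, hk⟩ := (natCast_cpow_neg_eq_one_iff hp z).1 (sub_eq_zero.1 h).symm
  exact hz (by rw [hk]; exact (pole_re_im p k).1)

/-- `ρ_p R_j` is complex differentiable off the imaginary axis, left of `Re z = 3/2`. [folklore] -/
private theorem differentiableAt_rhoPrime_kernel {p : ℕ} (hp : 1 < p) (j : ℕ) {z : ℂ}
    (hz0 : z.re ≠ 0) (hz : z.re < 3 / 2) :
    DifferentiableAt ℂ
      (fun z : ℂ => rhoPrime p z * (cayleyInv z ^ j * ((-8 : ℂ) / (2 * z - 3) ^ 2))) z := by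
  have hrho : DifferentiableAt ℂ (rhoPrime p) z := by
    rw [rhoPrime_eq_fun]
    exact (differentiable_num hp z).div (differentiable_den hp z) (one_sub_cpow_neg_ne_zero hp hz0)
  exact hrho.mul (differentiableAt_kernel (two_mul_sub_three_ne_zero hz) j)

/-- Continuity of `y ↦ (ρ_p R_j)(x + iy)` along a vertical line `Re z = x`, `x ≠ 0`, `x < 3/2`.
[folklore] -/
private theorem continuous_rhoPrime_kernel_vertical {p : ℕ} (hp : 1 < p) (j : ℕ) {x : ℝ}
    (hx0 : x ≠ 0) (hx : x < 3 / 2) :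
    Continuous fun y : ℝ => rhoPrime p (x + y * I) *
      (cayleyInv (x + y * I) ^ j * ((-8 : ℂ) / (2 * (x + y * I) - 3) ^ 2)) := by
  have hline : Continuous fun y : ℝ => (x : ℂ) + y * I := by fun_prop
  refine continuous_iff_continuousAt.2 fun y => ?_
  have hre : ((x : ℂ) + y * I).re = x := by simp
  exact ((differentiableAt_rhoPrime_kernel hp j (by rw [hre]; exact hx0)
    (by rw [hre]; exact hx)).continuousAt).comp (f := fun y : ℝ => (x : ℂ) + y * I)
    hline.continuousAt

/-- **The horizontal sides** `Im z = (2m+1)π/log p`, `Re z ≤ ½`: `|ρ_p R_j| ≤ 2 log²p/((2m+1)²π²)`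
(«the same control … of the integral on the segment `(½ + iR, ½ − 2m + iR)`»: `|ρ_p| ≤ 1` there and
`|2z − 3| ≥ 2|Im z| = 2R`). [cite: ConnesConsani2021QuasiInner, §3 (arXiv chunk p0008:L33–L39)] -/
private theorem norm_rhoPrime_kernel_horizontal_le {p : ℕ} (hp : 1 < p) (j : ℕ) (m : ℤ) {R x : ℝ}
    (hR : R = (2 * m + 1) * π / Real.log p) (hx : x ≤ 1 / 2) :
    ‖rhoPrime p (x + R * I) *
        (cayleyInv (x + R * I) ^ j * ((-8 : ℂ) / (2 * (x + R * I) - 3) ^ 2))‖ ≤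
      2 * Real.log p ^ 2 / ((2 * m + 1) ^ 2 * π ^ 2) := by
  have hlogR : 0 < Real.log p := Real.log_pos (by exact_mod_cast hp)
  have hodd : (2 * (m : ℝ) + 1) ≠ 0 := by
    intro h
    have : (2 * m + 1 : ℤ) = 0 := by exact_mod_cast h
    omega
  have h1 : ‖rhoPrime p (x + R * I)‖ ≤ 1 := by
    rw [hR]; exact norm_rhoPrime_le_one_of_re_le_half hp m hx
  have hre : ((x : ℂ) + R * I).re = x := by simp
  have him : ((x : ℂ) + R * I).im = R := by simp
  have h2 := norm_kernel_le (show ((x : ℂ) + R * I).re ≤ 1 / 2 by rw [hre]; exact hx) j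
  have h3 : 2 * |R| ≤ ‖2 * ((x : ℂ) + R * I) - 3‖ := by
    have := two_mul_abs_im_le_norm ((x : ℂ) + R * I)
    rwa [him] at this
  have hRpos : 0 < 2 * |R| := by
    rw [hR]
    exact mul_pos two_pos
      (abs_pos.2 (div_ne_zero (mul_ne_zero hodd Real.pi_ne_zero) hlogR.ne'))
  rw [norm_mul]
  calc ‖rhoPrime p (x + R * I)‖ *
        ‖cayleyInv (x + R * I) ^ j * ((-8 : ℂ) / (2 * (x + R * I) - 3) ^ 2)‖
      ≤ 1 * (8 / ‖2 * ((x : ℂ) + R * I) - 3‖ ^ 2) := mul_le_mul h1 h2 (norm_nonneg _) zero_le_one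
    _ ≤ 8 / (2 * |R|) ^ 2 := by
        rw [one_mul]
        exact div_le_div_of_nonneg_left (by norm_num) (pow_pos hRpos 2) (pow_le_pow_left₀ hRpos.le h3 2)
    _ = 2 * Real.log p ^ 2 / ((2 * m + 1) ^ 2 * π ^ 2) := by
        rw [mul_pow, sq_abs, hR]
        field_simp
        ring

/-- **The left side** `Re z = ½ − 2m` (`m ≥ 1`): `|ρ_p R_j| ≤ (1 + p⁻¹)/(p^{3/2} − 1) · 8/(4m+2)²`
(Lemma 3.1 (iii) with `ε = 3/2 ≤ 2m − ½`, and `|2z − 3| ≥ |2 Re z − 3| = 4m + 2`; the print uses the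
cruder `|ρ_p(½ − 2m + is)| ≤ 2(p^{2m−½} − 1)⁻¹`).
[cite: ConnesConsani2021QuasiInner, §3 (arXiv chunk p0008:L40–L46)] -/
private theorem norm_rhoPrime_kernel_left_le {p : ℕ} (hp : 1 < p) (j : ℕ) {m : ℕ} (hm : 1 ≤ m)
    (y : ℝ) :
    ‖rhoPrime p ((1 / 2 - 2 * m : ℝ) + y * I) * (cayleyInv ((1 / 2 - 2 * m : ℝ) + y * I) ^ j *
        ((-8 : ℂ) / (2 * ((1 / 2 - 2 * m : ℝ) + y * I) - 3) ^ 2))‖ ≤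
      (1 + (p : ℝ)⁻¹) / ((p : ℝ) ^ (3 / 2 : ℝ) - 1) * (8 / (4 * m + 2) ^ 2) := by
  have hm1 : (1 : ℝ) ≤ m := by exact_mod_cast hm
  have hp1 : (1 : ℝ) < p := by exact_mod_cast hp
  set z : ℂ := ((1 / 2 - 2 * m : ℝ) : ℂ) + y * I with hz
  have hre : z.re = 1 / 2 - 2 * m := by simp [hz]
  have h1 : ‖rhoPrime p z‖ ≤ (1 + (p : ℝ)⁻¹) / ((p : ℝ) ^ (3 / 2 : ℝ) - 1) :=
    norm_rhoPrime_le_of_re_le hp (by norm_num) (by rw [hre]; linarith)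
  have h2 := norm_kernel_le (show z.re ≤ 1 / 2 by rw [hre]; linarith) j
  have h3 : (4 * m + 2 : ℝ) ≤ ‖2 * z - 3‖ := by
    have := abs_re_le_norm' z
    rwa [hre, show (2 * (1 / 2 - 2 * (m : ℝ)) - 3) = -(4 * m + 2) by ring, abs_neg,
      abs_of_pos (by positivity)] at this
  have hC : 0 ≤ (1 + (p : ℝ)⁻¹) / ((p : ℝ) ^ (3 / 2 : ℝ) - 1) := by
    have : 1 < (p : ℝ) ^ (3 / 2 : ℝ) := Real.one_lt_rpow hp1 (by norm_num)
    exact div_nonneg (by positivity) (by linarith)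
  rw [norm_mul]
  calc ‖rhoPrime p z‖ * ‖cayleyInv z ^ j * ((-8 : ℂ) / (2 * z - 3) ^ 2)‖
      ≤ (1 + (p : ℝ)⁻¹) / ((p : ℝ) ^ (3 / 2 : ℝ) - 1) * (8 / ‖2 * z - 3‖ ^ 2) :=
        mul_le_mul h1 h2 (norm_nonneg _) hC
    _ ≤ (1 + (p : ℝ)⁻¹) / ((p : ℝ) ^ (3 / 2 : ℝ) - 1) * (8 / (4 * m + 2) ^ 2) := by
        gcongr

/-- **The right side** (critical line): `|ρ_p R_j(½ + iy)| ≤ 2/(1 + y²)` (`|ρ_p| = 1` there,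
`|2z − 3|² = 4(1 + y²)`). [cite: ConnesConsani2021QuasiInner, §3 (arXiv chunk p0008:L24–L33)] -/
private theorem norm_rhoPrime_kernel_critical_le {p : ℕ} (hp : 1 < p) (j : ℕ) (y : ℝ) :
    ‖rhoPrime p ((1 / 2 : ℝ) + y * I) * (cayleyInv ((1 / 2 : ℝ) + y * I) ^ j *
        ((-8 : ℂ) / (2 * ((1 / 2 : ℝ) + y * I) - 3) ^ 2))‖ ≤ 2 * (1 + y ^ 2)⁻¹ := by
  have hhalf : (((1 / 2 : ℝ) : ℂ) + y * I) = 1 / 2 + y * I := by push_cast; ring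
  rw [norm_mul, hhalf, norm_rhoPrime_critical_line hp y, one_mul]
  have hre : ((1 : ℂ) / 2 + y * I).re ≤ 1 / 2 := by simp
  refine (norm_kernel_le hre j).trans ?_
  have : ‖2 * (1 / 2 + (y : ℂ) * I) - 3‖ ^ 2 = 4 * (1 + y ^ 2) := by
    rw [show (2 * (1 / 2 + (y : ℂ) * I) - 3) = ((-2 : ℝ) : ℂ) + ((2 * y : ℝ) : ℂ) * I by
      push_cast; ring, Complex.sq_norm, Complex.normSq_add_mul_I]
    ring
  rw [this]
  apply le_of_eq
  field_simp
  norm_num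

/-- The boundary function on the critical line is integrable. [folklore] -/
private theorem integrable_rhoPrime_kernel_critical {p : ℕ} (hp : 1 < p) (j : ℕ) :
    Integrable fun y : ℝ => rhoPrime p ((1 / 2 : ℝ) + y * I) * (cayleyInv ((1 / 2 : ℝ) + y * I) ^ j *
        ((-8 : ℂ) / (2 * ((1 / 2 : ℝ) + y * I) - 3) ^ 2)) := by
  refine Integrable.mono' (integrable_inv_one_add_sq.const_mul 2)
    (continuous_rhoPrime_kernel_vertical hp j (by norm_num) (by norm_num)).aestronglyMeasurable
    (ae_of_all _ fun y => norm_rhoPrime_kernel_critical_le hp j y)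

/-- **The residue expansion of the negative Fourier coefficients of `κ_p`, transported to the critical
line** — the printed `a^{(p)}_{−k} = Σ_ℤ Res_{z = 2πin/log p}(ρ_p(z) ψ⁻¹(z)^{k−1} (−8)/(2z−3)²) =
8(1 − 1/p) log p Σ_ℤ (4πn + 3i log p)^{−2} x_p(n)^{k−1}` («We can thus apply the residue formula»),
in the form: for every `j ≥ 0`,
`Σ_{n ∈ ℤ} 8(1 − p⁻¹) log p (4πn + 3i log p)⁻² x_p(n)^j = (1/2π) ∫_ℝ ρ_p(½ + iy) ψ⁻¹(½ + iy)^j (−8)/(2(½ + iy) − 3)² dy`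
(the rectangles `[½ − 2m, ½] × [−(2m+1)π/log p, (2m+1)π/log p]` of
`rectBoundaryIntegral_rhoPrime_kernel`, `m → ∞`: the two horizontal sides and the left side tend to
`0` by the bounds above, the right side to the absolutely convergent line integral; the series
converges absolutely, `summable_residues_rhoPrime_kernel`).
[cite: ConnesConsani2021QuasiInner, §3 (arXiv chunk p0008:L24–L64)] -/
theorem hasSum_residues_rhoPrime_kernel {p : ℕ} (hp : p.Prime) (j : ℕ) :
    HasSum (fun n : ℤ => 8 * (1 - (p : ℂ)⁻¹) * Real.log p / (4 * π * n + 3 * I * Real.log p) ^ 2 *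
        xPrime p n ^ j)
      ((1 / (2 * π) : ℂ) * ∫ y : ℝ, rhoPrime p (1 / 2 + y * I) *
        (cayleyInv (1 / 2 + y * I) ^ j * ((-8 : ℂ) / (2 * (1 / 2 + y * I) - 3) ^ 2))) := by
  have hp1 : 1 < p := hp.one_lt
  have hp1R : (1 : ℝ) < p := by exact_mod_cast hp1
  have hlogR : 0 < Real.log p := Real.log_pos hp1R
  have hsum := summable_residues_rhoPrime_kernel hp1 j
  -- (i) the symmetric partial sums converge to the sum of the series
  have h_partial : Tendsto (fun m : ℕ => ∑ n ∈ Finset.Icc (-(m : ℤ)) m,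
      8 * (1 - (p : ℂ)⁻¹) * Real.log p / (4 * π * n + 3 * I * Real.log p) ^ 2 * xPrime p n ^ j)
      atTop (𝓝 (∑' n : ℤ, 8 * (1 - (p : ℂ)⁻¹) * Real.log p / (4 * π * n + 3 * I * Real.log p) ^ 2 *
        xPrime p n ^ j)) :=
    hsum.hasSum.comp Finset.tendsto_Icc_neg
  -- (ii) the height `R_m = (2m+1)π/log p → ∞`
  have hR : Tendsto (fun m : ℕ => (2 * (m : ℝ) + 1) * π / Real.log p) atTop atTop :=
    ((tendsto_atTop_add_const_right _ _ (tendsto_natCast_atTop_atTop.const_mul_atTop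
      (by norm_num : (0 : ℝ) < 2))).atTop_mul_const Real.pi_pos).atTop_div_const hlogR
  have h_small₁ : Tendsto (fun m : ℕ => Real.log p ^ 2 / π ^ 2 / (m : ℝ)) atTop (𝓝 0) :=
    tendsto_const_div_atTop_nhds_zero_nat _
  have h_small₂ : Tendsto (fun m : ℕ => (1 + (p : ℝ)⁻¹) / ((p : ℝ) ^ (3 / 2 : ℝ) - 1) *
      (4 * π / Real.log p) / (m : ℝ)) atTop (𝓝 0) :=
    tendsto_const_div_atTop_nhds_zero_nat _
  -- (iii) the right side converges to the line integral
  have h_right : Tendsto (fun m : ℕ =>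
      ∫ y in (-((2 * m + 1) * π / Real.log p))..((2 * m + 1) * π / Real.log p),
        rhoPrime p ((1 / 2 : ℝ) + y * I) * (cayleyInv ((1 / 2 : ℝ) + y * I) ^ j *
          ((-8 : ℂ) / (2 * ((1 / 2 : ℝ) + y * I) - 3) ^ 2))) atTop
      (𝓝 (∫ y : ℝ, rhoPrime p ((1 / 2 : ℝ) + y * I) * (cayleyInv ((1 / 2 : ℝ) + y * I) ^ j *
          ((-8 : ℂ) / (2 * ((1 / 2 : ℝ) + y * I) - 3) ^ 2)))) :=
    intervalIntegral_tendsto_integral (integrable_rhoPrime_kernel_critical hp1 j)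
      (tendsto_neg_atTop_atBot.comp hR) hR
  -- (iv) the top side tends to `0`
  have h_top : Tendsto (fun m : ℕ => ∫ x in (1 / 2 - 2 * m : ℝ)..(1 / 2 : ℝ),
      rhoPrime p (x + ((2 * m + 1) * π / Real.log p : ℝ) * I) *
        (cayleyInv (x + ((2 * m + 1) * π / Real.log p : ℝ) * I) ^ j *
          ((-8 : ℂ) / (2 * (x + ((2 * m + 1) * π / Real.log p : ℝ) * I) - 3) ^ 2))) atTop (𝓝 0) := by
    refine squeeze_zero_norm' ?_ h_small₁
    filter_upwards [eventually_ge_atTop 1] with m hm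
    have hm1 : (1 : ℝ) ≤ m := by exact_mod_cast hm
    refine (intervalIntegral.norm_integral_le_of_norm_le_const
      (C := 2 * Real.log p ^ 2 / ((2 * ((m : ℤ) : ℝ) + 1) ^ 2 * π ^ 2)) fun x hx => ?_).trans ?_
    · exact norm_rhoPrime_kernel_horizontal_le hp1 j (m : ℤ) (by push_cast; ring)
        (by rw [Set.uIoc_of_le (by linarith)] at hx; exact hx.2)
    · have hfrac : 4 * (m : ℝ) / (2 * m + 1) ^ 2 ≤ 1 / m := by
        rw [div_le_div_iff₀ (by positivity) (by positivity)]
        nlinarith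
      calc 2 * Real.log p ^ 2 / ((2 * ((m : ℤ) : ℝ) + 1) ^ 2 * π ^ 2) * |1 / 2 - (1 / 2 - 2 * (m : ℝ))|
          = Real.log p ^ 2 / π ^ 2 * (4 * m / (2 * m + 1) ^ 2) := by
            push_cast
            rw [abs_of_nonneg (by linarith)]
            field_simp
            ring
        _ ≤ Real.log p ^ 2 / π ^ 2 * (1 / m) := mul_le_mul_of_nonneg_left hfrac (by positivity)
        _ = Real.log p ^ 2 / π ^ 2 / m := by ring
  -- (v) the bottom side tends to `0`
  have h_bot : Tendsto (fun m : ℕ => ∫ x in (1 / 2 - 2 * m : ℝ)..(1 / 2 : ℝ),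
      rhoPrime p (x + (-((2 * m + 1) * π / Real.log p) : ℝ) * I) *
        (cayleyInv (x + (-((2 * m + 1) * π / Real.log p) : ℝ) * I) ^ j *
          ((-8 : ℂ) / (2 * (x + (-((2 * m + 1) * π / Real.log p) : ℝ) * I) - 3) ^ 2)))
      atTop (𝓝 0) := by
    refine squeeze_zero_norm' ?_ h_small₁
    filter_upwards [eventually_ge_atTop 1] with m hm
    have hm1 : (1 : ℝ) ≤ m := by exact_mod_cast hm
    refine (intervalIntegral.norm_integral_le_of_norm_le_const
      (C := 2 * Real.log p ^ 2 / ((2 * ((-(m : ℤ) - 1 : ℤ) : ℝ) + 1) ^ 2 * π ^ 2))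
      fun x hx => ?_).trans ?_
    · exact norm_rhoPrime_kernel_horizontal_le hp1 j (-(m : ℤ) - 1) (by push_cast; ring)
        (by rw [Set.uIoc_of_le (by linarith)] at hx; exact hx.2)
    · have hfrac : 4 * (m : ℝ) / (2 * m + 1) ^ 2 ≤ 1 / m := by
        rw [div_le_div_iff₀ (by positivity) (by positivity)]
        nlinarith
      calc 2 * Real.log p ^ 2 / ((2 * ((-(m : ℤ) - 1 : ℤ) : ℝ) + 1) ^ 2 * π ^ 2) *
            |1 / 2 - (1 / 2 - 2 * (m : ℝ))|
          = Real.log p ^ 2 / π ^ 2 * (4 * m / (2 * m + 1) ^ 2) := by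
            push_cast
            rw [abs_of_nonneg (by linarith),
              show (2 * (-(m : ℝ) - 1) + 1) ^ 2 = (2 * m + 1) ^ 2 by ring]
            field_simp
            ring
        _ ≤ Real.log p ^ 2 / π ^ 2 * (1 / m) := mul_le_mul_of_nonneg_left hfrac (by positivity)
        _ = Real.log p ^ 2 / π ^ 2 / m := by ring
  -- (vi) the left side tends to `0`
  have h_left : Tendsto (fun m : ℕ =>
      ∫ y in (-((2 * m + 1) * π / Real.log p))..((2 * m + 1) * π / Real.log p),
        rhoPrime p ((1 / 2 - 2 * m : ℝ) + y * I) * (cayleyInv ((1 / 2 - 2 * m : ℝ) + y * I) ^ j *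
          ((-8 : ℂ) / (2 * ((1 / 2 - 2 * m : ℝ) + y * I) - 3) ^ 2))) atTop (𝓝 0) := by
    refine squeeze_zero_norm' ?_ h_small₂
    filter_upwards [eventually_ge_atTop 1] with m hm
    have hm1 : (1 : ℝ) ≤ m := by exact_mod_cast hm
    have hC : 0 ≤ (1 + (p : ℝ)⁻¹) / ((p : ℝ) ^ (3 / 2 : ℝ) - 1) := by
      have : 1 < (p : ℝ) ^ (3 / 2 : ℝ) := Real.one_lt_rpow hp1R (by norm_num)
      exact div_nonneg (by positivity) (by linarith)
    refine (intervalIntegral.norm_integral_le_of_norm_le_const fun y _ =>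
      norm_rhoPrime_kernel_left_le hp1 j hm y).trans ?_
    calc (1 + (p : ℝ)⁻¹) / ((p : ℝ) ^ (3 / 2 : ℝ) - 1) * (8 / (4 * m + 2) ^ 2) *
          |(2 * m + 1) * π / Real.log p - -((2 * m + 1) * π / Real.log p)|
        = (1 + (p : ℝ)⁻¹) / ((p : ℝ) ^ (3 / 2 : ℝ) - 1) * (4 * π / Real.log p) *
            (1 / (2 * m + 1)) := by
          rw [sub_neg_eq_add, abs_of_nonneg (by positivity)]
          field_simp
          ring
      _ ≤ (1 + (p : ℝ)⁻¹) / ((p : ℝ) ^ (3 / 2 : ℝ) - 1) * (4 * π / Real.log p) * (1 / m) := by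
          gcongr
          linarith
      _ = _ := by ring
  -- (vii) hence the boundary integrals converge to `i ∫_ℝ (ρ_p R_j)(½ + iy) dy`
  have h_box : Tendsto (fun m : ℕ => Literature.Analysis.Complex.rectBoundaryIntegral
        (fun z : ℂ => rhoPrime p z * (cayleyInv z ^ j * ((-8 : ℂ) / (2 * z - 3) ^ 2)))
        (1 / 2 - 2 * m) (1 / 2) (-((2 * m + 1) * π / Real.log p)) ((2 * m + 1) * π / Real.log p))
      atTop (𝓝 (0 - 0 + I * (∫ y : ℝ, rhoPrime p ((1 / 2 : ℝ) + y * I) *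
        (cayleyInv ((1 / 2 : ℝ) + y * I) ^ j * ((-8 : ℂ) / (2 * ((1 / 2 : ℝ) + y * I) - 3) ^ 2))) -
          I * 0)) :=
    ((h_bot.sub h_top).add (h_right.const_mul I)).sub (h_left.const_mul I)
  -- (viii) … and by the residue formula they are `2πi` times the partial sums
  have h2πI : (2 * π * I : ℂ) ≠ 0 := by simp [Real.pi_ne_zero, I_ne_zero]
  have h_val : Tendsto (fun m : ℕ => ∑ n ∈ Finset.Icc (-(m : ℤ)) m,
      8 * (1 - (p : ℂ)⁻¹) * Real.log p / (4 * π * n + 3 * I * Real.log p) ^ 2 * xPrime p n ^ j)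
      atTop (𝓝 (1 / (2 * π * I) * (0 - 0 + I * (∫ y : ℝ, rhoPrime p ((1 / 2 : ℝ) + y * I) *
        (cayleyInv ((1 / 2 : ℝ) + y * I) ^ j * ((-8 : ℂ) / (2 * ((1 / 2 : ℝ) + y * I) - 3) ^ 2))) -
          I * 0))) := by
    refine (h_box.const_mul (1 / (2 * π * I))).congr' ?_
    filter_upwards [eventually_ge_atTop 1] with m hm
    rw [rectBoundaryIntegral_rhoPrime_kernel hp j hm, ← mul_assoc, one_div_mul_cancel h2πI, one_mul]
  have h_eq := tendsto_nhds_unique h_partial h_val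
  have hhalf : ∀ y : ℝ, (((1 / 2 : ℝ) : ℂ) + y * I) = 1 / 2 + y * I := fun y => by push_cast; ring
  simp_rw [hhalf] at h_eq
  rw [show (1 / (2 * π) : ℂ) * (∫ y : ℝ, rhoPrime p (1 / 2 + y * I) *
        (cayleyInv (1 / 2 + y * I) ^ j * ((-8 : ℂ) / (2 * (1 / 2 + y * I) - 3) ^ 2))) =
      ∑' n : ℤ, 8 * (1 - (p : ℂ)⁻¹) * Real.log p / (4 * π * n + 3 * I * Real.log p) ^ 2 *
        xPrime p n ^ j by
    rw [h_eq, sub_zero, zero_add, mul_zero, sub_zero, ← mul_assoc]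
    congr 1
    field_simp]
  exact hsum.hasSum

end QuasiInner

end Literature.NumberTheory.ConnesConsani2021

end
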